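/-
Copyright (c) 2026 the pub-hodgecm-mathlib formalisation cell (harness21).  Prover seat hodgecm-mathlib-F0P3-p02 (g26), 2026-09-03.  E1 row 34b «CONVEX SUPPORT» (E1 keeper ∕
dealer F0P3a-p03 (g29) 01:26:59Z: the finite-convex-subcomplex form of ★ row 34 `SchneiderStuhlerTreeExactness`, [MeyerSolleveld2010] Thm. 2.4 with `Σ` a convex subcomplex).
-/
import Literature.NumberTheory.Automorphic.SchneiderStuhlerTreeExactness   -- ★ row 34: `TreeLayers.dist_eq_dist_parent_add_one_of_depth_le`, `Representation.apply_mem_fixedPoints_sup_of_forall_dist`, `boundary_add`, `boundary_single_edge`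
import HarnessLib

/-!
# The Schneider–Stuhler tree complex is exact at `C₀` INSIDE A CONVEX SUBTREE: a `0`-cycle supported in a root-closed vertex set `S` bounds a `1`-chain supported on edges of `S`

Topic `NumberTheory/Automorphic` (declarations in the `Representation` namespace, next to ★ row 34).  THEOREMS ONLY (no definition, no instance, no notation, no named
fact, no `sorry`).  Cell `pub/hodgecm-mathlib` (D-0151), crux H413 = `stmt-HodgeConjecture-24833`, lane `--supports`; E1 BRICK LEDGER row 34b (keeper F0P3a-p03 (g29)
01:26:59Z «(o6) CONVEX SUPPORT: the peeling never leaves a parent-closed `S ⊇ supp v`, so `c` is supported on edges inside `S` = MS10's finite-convex-`Σ` form»).  A sibling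
file rather than an append-only edition of ★ row 34 (384 l.) because of the 400-line fence.  HONEST LABEL: count-neutral generic base layer of the (R-SS) resolution engine
((U6), (U7) hypotheses; (R-SS)∕(K) not chartered); HC_CM is proved only modulo the 2 remaining named inputs (hLiu418 = `stmt-HodgeConjecture-24832`, h413 =
`stmt-HodgeConjecture-24833`) until rung 0 closes.

THE MATHEMATICS ([MeyerSolleveld2010] Thm. 2.4 for a convex subcomplex `Σ` of the building; here the tree case).  Letters of ★ row 34: `G` a tree on `ι`, `σ` an orientation,
`U : ι → Subgroup Γ` compact vertex groups with (U6) on edges and (U7) along first steps of geodesics, `ρ` a representation of `Γ` on the `k`-space `V` (`char k = 0`), `0`-chains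
`v : ι →₀ V` with `v_z ∈ V^{U_z}` smooth, `1`-chains `c : G.edgeSet →₀ V` with `c_e ∈ V^{U_{head e} ⊔ U_{tail e}}`, boundary `(∂c)_u = Σ_e D_{ue} • c_e`.  A vertex set `S` is
ROOT-CLOSED for the root `r` when it contains, with every `x ∈ S`, the neighbour of `x` one step closer to `r` (`x ~ y`, `dist(r,y) + 1 = dist(r,x) ⇒ y ∈ S`); in a tree
these are exactly the CONVEX vertex sets containing `r` (subtrees through `r`), e.g. a finite convex subcomplex `Σ ∋ r` or the shadow of `r`-descendants.  THEOREM: if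
`supp v ⊆ S` and `Σ v = 0` then `v = ∂c` with `c` supported on edges `e ⊆ S` (both ends in `S`).  PROOF: the leaf peeling of ★ row 34 rooted AT `r`: the peeled vertex `x` of
maximal depth lies in `S`, its parent `y` lies in `S` (root-closed), so the new `0`-chain `v − v_x·[x] + v_x·[y]` is again supported in `S` and the edge `{x, y}` lies in `S`.
This is the form in which the complex of a FINITE `𝒦`-invariant convex subtree `Σ` resolves `V|_Σ = Σ_{x ∈ Σ} V^{U_x}` by finite-dimensional `𝒦`-modules (MS10 p. 4: the
trace of a compactly supported Hecke operator on an admissible `V` is computed on `V|_Σ`).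

* `exists_single_edge_boundary_eq_of_adj` — the edge chain of ★ `exists_single_edge_boundary_eq` WITH its support (`⊆ {s(x,y)}`).
* **`exists_finsupp_fixedPoints_boundary_eq_of_support_subset`** — exactness at `C₀` with `c` supported on edges inside the root-closed `S ⊇ supp v`.

## References
* [MeyerSolleveld2010] R. Meyer, M. Solleveld, *Resolutions for representations of reductive p-adic groups via their buildings*, J. reine angew. Math. 647 (2010): Thm. 2.4 (the
  cellular chain complex of a CONVEX subcomplex `Σ` is exact except in degree `0`, where `H₀ = Σ_{x ∈ Σ°} P_x(V)`), §1 p. 4 (the trace recipe on a finite convex `Σ`).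
* [SchneiderStuhler1997] P. Schneider, U. Stuhler, *Representation theory and sheaves on the Bruhat–Tits building*, Publ. Math. IHÉS 85 (1997): Thm. II.3.1 p. 123.
* [Serre1980Trees] J.-P. Serre, *Trees* (1980): I.2.3 (subtrees and geodesics).
-/

set_option autoImplicit false

open scoped BigOperators Pointwise
open SimpleGraph Finset
open Literature.NumberTheory.Automorphic Literature.Combinatorics.SimpleGraph Literature.Combinatorics.SimpleGraph.OrientedIncidence
open Literature.Combinatorics.SimpleGraph.TreeLayers

namespace Representation

variable {k Γ V : Type*} [Field k] [CharZero k] [Group Γ] [TopologicalSpace Γ] [IsTopologicalGroup Γ]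
  [AddCommGroup V] [Module k V] {ρ : Representation k Γ V}
variable {ι : Type*} {G : SimpleGraph ι}

omit [CharZero k] in
/-- The edge chain of ★ `exists_single_edge_boundary_eq`, WITH ITS SUPPORT: for `x ~ y` and `m ∈ V^{U_x ⊔ U_y}` smooth there is a `1`-chain supported on the single edge
`{x, y}`, with coefficient in `V^{U_{head} ⊔ U_{tail}}`, smooth, and boundary `m·[x] − m·[y]`. [cite: SchneiderStuhler1997, Ch. II §3 p. 123] -/
theorem exists_single_edge_boundary_eq_of_adj [DecidableEq ι] (σ : Orientation G) (U : ι → Subgroup Γ) {x y : ι} (hxy : G.Adj x y) {m : V}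
    (hm : m ∈ ρ.fixedPoints (U x ⊔ U y)) (hms : ρ.IsSmoothVector m) :
    ∃ c : G.edgeSet →₀ V, (∀ e ∈ c.support, (e : Sym2 ι) = s(x, y)) ∧ (∀ e, c e ∈ ρ.fixedPoints (U (σ.head e) ⊔ U (σ.tail e))) ∧
      (∀ e, ρ.IsSmoothVector (c e)) ∧ ∀ u, (c.sum fun e m' => σ.incMatrix k u e • m') = (Finsupp.single x m - Finsupp.single y m) u := by
  set e₀ : G.edgeSet := ⟨s(x, y), hxy⟩
  have hsupp : ∀ (m' : V), ∀ e ∈ (Finsupp.single e₀ m').support, (e : Sym2 ι) = s(x, y) := fun m' e he => by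
    have := Finsupp.support_single_subset he
    rw [Finset.mem_singleton] at this
    rw [this]
  rcases σ.head_tail_of_adj hxy with ⟨hh, ht⟩ | ⟨hh, ht⟩
  · refine ⟨Finsupp.single e₀ m, hsupp m, fun e => ?_, fun e => ?_, fun u => ?_⟩
    · by_cases he : e = e₀
      · subst he; rw [Finsupp.single_eq_same, hh, ht]; exact hm
      · rw [Finsupp.single_eq_of_ne he]; exact Submodule.zero_mem _
    · by_cases he : e = e₀
      · subst he; rw [Finsupp.single_eq_same]; exact hms
      · rw [Finsupp.single_eq_of_ne he]; exact ρ.isSmoothVector_zero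
    · rw [boundary_single_edge, hh, ht, Finsupp.sub_apply, Finsupp.single_apply, Finsupp.single_apply]
      simp only [eq_comm]
  · refine ⟨Finsupp.single e₀ (-m), hsupp (-m), fun e => ?_, fun e => ?_, fun u => ?_⟩
    · by_cases he : e = e₀
      · subst he; rw [Finsupp.single_eq_same, hh, ht, sup_comm]; exact Submodule.neg_mem _ hm
      · rw [Finsupp.single_eq_of_ne he]; exact Submodule.zero_mem _
    · by_cases he : e = e₀
      · subst he; rw [Finsupp.single_eq_same, ← neg_one_smul k]; exact IsSmoothVector.smul ρ _ hms
      · rw [Finsupp.single_eq_of_ne he]; exact ρ.isSmoothVector_zero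
    · rw [boundary_single_edge, hh, ht, Finsupp.sub_apply, Finsupp.single_apply, Finsupp.single_apply]
      by_cases hux : u = x <;> by_cases huy : u = y
      · exact absurd (hux.symm.trans huy) hxy.ne
      · subst hux; simp [huy, Ne.symm huy]
      · subst huy; simp [hux, Ne.symm hux]
      · simp [hux, huy, Ne.symm hux, Ne.symm huy]

/-- **EXACTNESS AT `C₀` INSIDE A ROOT-CLOSED (CONVEX) VERTEX SET.**  `G` a tree, `U` compact vertex groups with (U6) on edges and (U7) along first steps of geodesics (letters of
★ row 34), a root `r` and `S ⊆ ι` root-closed (`x ∈ S`, `x ~ y`, `dist(r,y) + 1 = dist(r,x) ⇒ y ∈ S`; then `r ∈ S` as soon as `S ≠ ∅`); then every `0`-chain `v` with `v_z ∈ V^{U_z}` smooth, `supp v ⊆ S` and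
`Σ_z v_z = 0` is the boundary of a `1`-chain `c` with `c_e ∈ V^{U_{head e} ⊔ U_{tail e}}` smooth and SUPPORTED ON EDGES OF `S` (both ends in `S`).  Leaf peeling rooted at `r`:
the parent of a vertex of `S` stays in `S`. [cite: MeyerSolleveld2010, Thm. 2.4] [cite: SchneiderStuhler1997, Thm. II.3.1 p. 123] -/
theorem exists_finsupp_fixedPoints_boundary_eq_of_support_subset [DecidableEq ι] (hT : G.IsTree) (σ : Orientation G)
    (U : ι → Subgroup Γ) (hU : ∀ z, IsCompact (U z : Set Γ))
    (hU6 : ∀ x y, G.Adj x y → ((U x ⊔ U y : Subgroup Γ) : Set Γ) = (U x : Set Γ) * (U y : Set Γ))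
    (hU7 : ∀ x y z, G.Adj x y → G.dist y z + 1 = G.dist x z → ((U y : Subgroup Γ) : Set Γ) ⊆ (U x : Set Γ) * (U z : Set Γ))
    {r : ι} {S : Set ι} (hS : ∀ x ∈ S, ∀ y, G.Adj x y → G.dist r y + 1 = G.dist r x → y ∈ S)
    (v : ι →₀ V) (hfix : ∀ z, v z ∈ ρ.fixedPoints (U z)) (hsm : ∀ z, ρ.IsSmoothVector (v z)) (hvS : ∀ z ∈ v.support, z ∈ S)
    (hsum : v.sum (fun _ m => m) = 0) :
    ∃ c : G.edgeSet →₀ V, (∀ e ∈ c.support, σ.head e ∈ S ∧ σ.tail e ∈ S) ∧ (∀ e, c e ∈ ρ.fixedPoints (U (σ.head e) ⊔ U (σ.tail e))) ∧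
      (∀ e, ρ.IsSmoothVector (c e)) ∧ ∀ u, (c.sum fun e m => σ.incMatrix k u e • m) = v u := by
  classical
  have hc : G.Connected := hT.1
  obtain ⟨p, hpar, hchild, hroot, -⟩ := exists_rooted_parent hT r
  -- induction on the potential `Φ(w) = Σ_{z ∈ supp w} (dist(r,z) + 1)`, with the invariant `supp w ⊆ S`
  suffices key : ∀ (n : ℕ) (w : ι →₀ V), (∑ z ∈ w.support, (G.dist r z + 1)) ≤ n → (∀ z, w z ∈ ρ.fixedPoints (U z)) → (∀ z, ρ.IsSmoothVector (w z)) →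
      (∀ z ∈ w.support, z ∈ S) → w.sum (fun _ m => m) = 0 →
      ∃ c : G.edgeSet →₀ V, (∀ e ∈ c.support, σ.head e ∈ S ∧ σ.tail e ∈ S) ∧ (∀ e, c e ∈ ρ.fixedPoints (U (σ.head e) ⊔ U (σ.tail e))) ∧
        (∀ e, ρ.IsSmoothVector (c e)) ∧ ∀ u, (c.sum fun e m => σ.incMatrix k u e • m) = w u from
    key _ v le_rfl hfix hsm hvS hsum
  have hzero : ∀ w : ι →₀ V, w = 0 → ∃ c : G.edgeSet →₀ V, (∀ e ∈ c.support, σ.head e ∈ S ∧ σ.tail e ∈ S) ∧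
      (∀ e, c e ∈ ρ.fixedPoints (U (σ.head e) ⊔ U (σ.tail e))) ∧ (∀ e, ρ.IsSmoothVector (c e)) ∧ ∀ u, (c.sum fun e m => σ.incMatrix k u e • m) = w u := by
    rintro w rfl
    exact ⟨0, fun e he => absurd he (by simp), fun _ => Submodule.zero_mem _, fun _ => ρ.isSmoothVector_zero, fun u => by simp⟩
  intro n
  induction n with
  | zero =>
    intro w hΦ hwfix hwsm hwS hwsum
    refine hzero w (Finsupp.support_eq_empty.1 ?_)
    by_contra hne
    obtain ⟨z, hz⟩ := Finset.nonempty_iff_ne_empty.2 hne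
    have := Finset.single_le_sum (f := fun z => G.dist r z + 1) (fun _ _ => Nat.zero_le _) hz
    omega
  | succ n ih =>
    intro w hΦ hwfix hwsm hwS hwsum
    by_cases hw0 : w = 0
    · exact hzero w hw0
    have hne : w.support.Nonempty := Finset.nonempty_iff_ne_empty.2 (by rwa [Ne, Finsupp.support_eq_empty])
    -- a support vertex of maximal depth
    obtain ⟨x, hx, hxmax⟩ := Finset.exists_max_image w.support (fun z => G.dist r z) hne
    by_cases hxr : x = r
    · -- then the support is `{r}` and `w r = Σ w = 0`: contradiction with `r ∈ supp`
      exfalso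
      have hsub : w.support ⊆ {r} := by
        intro z hz
        have hz0 : G.dist r z = 0 := by
          have := hxmax z hz
          rw [hxr, SimpleGraph.dist_self] at this
          omega
        exact Finset.mem_singleton.2 ((hc.dist_eq_zero_iff.1 hz0).symm)
      have hwr : w r = 0 := by
        have : w.sum (fun _ m => m) = ∑ z ∈ {r}, w z := by
          rw [Finsupp.sum]
          exact Finset.sum_subset hsub fun z _ hz => Finsupp.notMem_support_iff.1 hz
        rw [this, Finset.sum_singleton] at hwsum
        exact hwsum
      rw [hxr] at hx
      exact (Finsupp.mem_support_iff.1 hx) hwr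
    -- the parent `y` of `x`; it lies in `S`
    obtain ⟨hxy, hdy⟩ := hpar x hxr
    set y := p x with hy
    have hxS : x ∈ S := hwS x hx
    have hyS : y ∈ S := hS x hxS y hxy hdy
    -- the key algebra: `w x ∈ V^{U_x ⊔ U_y}`
    have hmem : w x ∈ ρ.fixedPoints (U x ⊔ U y) :=
      apply_mem_fixedPoints_sup_of_forall_dist (G := G) U hU (hU6 x y hxy) (fun z hz => hU7 x y z hxy hz) w hwfix hwsm hwsum
        fun z hz hzx => dist_eq_dist_parent_add_one_of_depth_le hc hchild hroot hzx (hxmax z hz)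
    -- peel: `w' = w - w x·[x] + w x·[y]`
    set w' : ι →₀ V := w - Finsupp.single x (w x) + Finsupp.single y (w x) with hw'
    have hyx : y ≠ x := fun h => hxy.ne h.symm
    have hw'x : w' x = 0 := by
      simp [hw', hyx]
    have hw'y : w' y = w y + w x := by
      simp [hw', hyx.symm]
    have hw'z : ∀ z, z ≠ x → z ≠ y → w' z = w z := fun z hzx hzy => by
      simp [hw', Ne.symm hzx, Ne.symm hzy]
    have hw'fix : ∀ z, w' z ∈ ρ.fixedPoints (U z) := by
      intro z
      by_cases hzx : z = x
      · rw [hzx, hw'x]; exact Submodule.zero_mem _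
      · by_cases hzy : z = y
        · rw [hzy, hw'y]
          exact Submodule.add_mem _ (hwfix y) (ρ.fixedPoints_antitone (le_sup_right : U y ≤ U x ⊔ U y) hmem)
        · rw [hw'z z hzx hzy]; exact hwfix z
    have hw'sm : ∀ z, ρ.IsSmoothVector (w' z) := by
      intro z
      by_cases hzx : z = x
      · rw [hzx, hw'x]; exact ρ.isSmoothVector_zero
      · by_cases hzy : z = y
        · rw [hzy, hw'y]; exact IsSmoothVector.add ρ (hwsm y) (hwsm x)
        · rw [hw'z z hzx hzy]; exact hwsm z
    have hw'sum : w'.sum (fun _ m => m) = 0 := by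
      have h1 : (w - Finsupp.single x (w x) + Finsupp.single y (w x)).sum (fun _ m => m)
          = w.sum (fun _ m => m) - (Finsupp.single x (w x)).sum (fun _ m => m) + (Finsupp.single y (w x)).sum (fun _ m => m) := by
        rw [Finsupp.sum_add_index' (fun _ => rfl) (fun _ _ _ => rfl), Finsupp.sum_sub_index (fun _ _ _ => rfl)]
      rw [hw', h1, hwsum, Finsupp.sum_single_index rfl, Finsupp.sum_single_index rfl, zero_sub, neg_add_cancel]
    -- the new support lies in `S` and the potential drops
    have hsupp' : w'.support ⊆ insert y (w.support.erase x) := by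
      intro z hz
      rw [Finset.mem_insert, Finset.mem_erase]
      by_cases hzy : z = y
      · exact Or.inl hzy
      · right
        have hzx : z ≠ x := by
          rintro rfl
          exact (Finsupp.mem_support_iff.1 hz) hw'x
        refine ⟨hzx, ?_⟩
        rw [Finsupp.mem_support_iff] at hz ⊢
        rwa [hw'z z hzx hzy] at hz
    have hw'S : ∀ z ∈ w'.support, z ∈ S := by
      intro z hz
      rcases Finset.mem_insert.1 (hsupp' hz) with hzy | hz'
      · rw [hzy]; exact hyS
      · exact hwS z (Finset.mem_of_mem_erase hz')
    have hΦ' : (∑ z ∈ w'.support, (G.dist r z + 1)) ≤ n := by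
      have h1 : (∑ z ∈ w'.support, (G.dist r z + 1)) ≤ ∑ z ∈ insert y (w.support.erase x), (G.dist r z + 1) :=
        Finset.sum_le_sum_of_subset_of_nonneg hsupp' fun _ _ _ => Nat.zero_le _
      have h2 : (∑ z ∈ insert y (w.support.erase x), (G.dist r z + 1)) ≤ (G.dist r y + 1) + ∑ z ∈ w.support.erase x, (G.dist r z + 1) := by
        by_cases hyin : y ∈ w.support.erase x
        · rw [Finset.insert_eq_of_mem hyin]; omega
        · rw [Finset.sum_insert hyin]
      have h3 : (∑ z ∈ w.support.erase x, (G.dist r z + 1)) + (G.dist r x + 1) = ∑ z ∈ w.support, (G.dist r z + 1) :=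
        Finset.sum_erase_add _ _ hx
      omega
    -- induct and add the edge chain (supported on `{x, y} ⊆ S`)
    obtain ⟨c', hc'S, hc'fix, hc'sm, hc'bd⟩ := ih w' hΦ' hw'fix hw'sm hw'S hw'sum
    obtain ⟨c₀, hc₀S, hc₀fix, hc₀sm, hc₀bd⟩ := exists_single_edge_boundary_eq_of_adj σ U hxy hmem (hwsm x)
    refine ⟨c' + c₀, fun e he => ?_, fun e => Submodule.add_mem _ (hc'fix e) (hc₀fix e), fun e => IsSmoothVector.add ρ (hc'sm e) (hc₀sm e), fun u => ?_⟩
    · rcases Finset.mem_union.1 (Finsupp.support_add he) with he' | he₀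
      · exact hc'S e he'
      · have hexy : (e : Sym2 ι) = s(x, y) := hc₀S e he₀
        have hends : ∀ u ∈ (e : Sym2 ι), u ∈ S := fun u hu => by
          rw [hexy, Sym2.mem_iff] at hu
          rcases hu with rfl | rfl
          · exact hxS
          · exact hyS
        exact ⟨hends _ (σ.head_mem e), hends _ (σ.tail_mem e)⟩
    · rw [boundary_add, hc'bd, hc₀bd, hw']
      simp only [Finsupp.add_apply, Finsupp.sub_apply]
      abel

end Representation
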